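import Mathlib
import HarnessLib
import Summits.NavierStokesRegularity.NavierStokesRegularity.Theorems.HalfSpaceWindowDoorCirculationCarryingRigidityDefs
import Summits.NavierStokesRegularity.NavierStokesRegularity.Theorems.HalfSpaceWindowDoorCirculationCarryingRigidityRotate
import Summits.NavierStokesRegularity.NavierStokesRegularity.Theorems.HalfSpaceWindowDoorCirculationCarryingRigidityWindowedFlux

/-!
# Route `HalfSpaceWindowDoor`, crux `CirculationCarryingRigidity` (stmt-NavierStokesRegularity-25311) — REDUCTION of the
# crux to the `e₃`-Liouville statement, and the DISC CIRCULATION law of closed-hemisphere profiles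

With the two landed stubs of the skeleton of record (`…Rotate.stub_rotate`, `…WindowedFlux.stub_windowedFluxDecay`) the
crux bookkeeping collapses:

* `stubLayerExclusion_iff_hemisphereLiouvilleE3` — the open research stub `StubLayerExclusion` is EQUIVALENT to the bare
  Liouville statement `HemisphereLiouvilleE3` (its extra hypothesis `WindowedFluxDecay C v` is a theorem of the class, hence
  idle): what remains of 25311 is exactly "closed-hemisphere Type-I ancient Oseen-mild profiles are poloidal along `e₃`";
* `circulationCarryingRigidity_of_stubLayerExclusion` — the composition of the skeleton: the open stub alone now gives the
  route decl `CirculationCarryingRigidity` BY NAME (one-line closing file once `stub_layerExclusion` lands);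
* `setLIntegral_ball_inner_curl_e3_le` — the DISC form of the windowed flux decay for the sign class: on every horizontal
  plane and every disc of radius `L`, `∫_{B_L(a)} ⟪curl v(s)(y₀,y₁,c), e₃⟫ dy ≤ 16π e^{1/4} C · L/√(−s)` — disc circulations
  of a closed-hemisphere profile grow at most LINEARLY in the radius (Kelvin–Stokes), the quantitative input any attack on
  the layer-exclusion stub starts from (`g_{L,a} ≥ e^{−1/4}/(4πL²)` on the disc).

Seat ns-hsw-p1 (LEAD of 25311, cell pub-ns-dss).  WHAT THIS IS NOT: not a statement about Navier–Stokes regularity; door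
criteria concern HYPOTHETICAL Type-I blow-up profiles; helper lemmas `--supports` the crux item, no closure claim.
-/

noncomputable section

-- the summit and its single sub-problem share the name (CONVENTIONS §1), as in every Theorems file
set_option linter.dupNamespace false

namespace Summit.NavierStokesRegularity.NavierStokesRegularity.Theorems.HalfSpaceWindowDoorCirculationCarryingRigidityReduction

open MeasureTheory Set Function Filter Topology
open scoped RealInnerProductSpace InnerProductSpace ENNReal
open Literature.Analysis Literature.Analysis.FluidPDE Literature.Analysis.UnboundedOperators
open Summit.NavierStokesRegularity.NavierStokesRegularity.Theses.HalfSpaceWindowDoor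
open Summit.NavierStokesRegularity.NavierStokesRegularity.Theorems.HalfSpaceWindowDoorCirculationCarryingRigidityDefs
open Summit.NavierStokesRegularity.NavierStokesRegularity.Theorems.HalfSpaceWindowDoorCirculationCarryingRigidityRotate (stub_rotate)
open Summit.NavierStokesRegularity.NavierStokesRegularity.Theorems.HalfSpaceWindowDoorCirculationCarryingRigidityWindowedFlux
  (stub_windowedFluxDecay gaussWin_pos windowedCirculation_le)
open Summit.NavierStokesRegularity.NavierStokesRegularity.Theorems.LocalSineTubeDoorProfileAlignedWindowRigidityAncient
  (bdd_of_hasTypeITimeDecay analyticOnNhd_slice)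
open Summit.NavierStokesRegularity.NavierStokesRegularity.Theorems.PoloidalWindowDoorPoloidalWindowRigidityClassSpaceTimeRates
  (exists_fderiv_rate_of_class')

/-! ### The crux is the `e₃`-Liouville statement -/

/-- **The open stub is the bare Liouville statement.**  `StubLayerExclusion ↔ HemisphereLiouvilleE3`: the hypothesis
`WindowedFluxDecay C v` of the layer-exclusion stub is discharged by the landed `stub_windowedFluxDecay`, so it is idle. -/
theorem stubLayerExclusion_iff_hemisphereLiouvilleE3 : StubLayerExclusion ↔ HemisphereLiouvilleE3 := by
  constructor
  · intro h C v hdecay hcont hmild hdiv hnn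
    exact h C v hdecay hcont hmild hdiv hnn (stub_windowedFluxDecay C v hdecay hcont hmild hdiv hnn)
  · intro h C v hdecay hcont hmild hdiv hnn _
    exact h C v hdecay hcont hmild hdiv hnn

/-- **Composition of the skeleton of record with its two landed stubs**: the open stub `StubLayerExclusion` alone implies
the route decl `CirculationCarryingRigidity` (via `stub_rotate`). -/
theorem circulationCarryingRigidity_of_stubLayerExclusion (h : StubLayerExclusion) : CirculationCarryingRigidity :=
  stub_rotate (stubLayerExclusion_iff_hemisphereLiouvilleE3.1 h)

/-- The same with the Liouville statement as hypothesis (a restatement of `stub_rotate` under its unfolded name). -/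
theorem circulationCarryingRigidity_of_hemisphereLiouvilleE3 (h : HemisphereLiouvilleE3) : CirculationCarryingRigidity :=
  stub_rotate h

/-! ### Disc circulations of closed-hemisphere profiles grow at most linearly in the radius -/

/-- On the disc `B_L(a)` the window of width `L` is bounded below: `e^{−1/4}/(4πL²) ≤ g_{L,a}(y)` for `‖y − a‖ < L`. -/
theorem gaussWin_ge_on_ball {L : ℝ} (hL : 0 < L) {a y : EuclideanSpace ℝ (Fin 2)} (hy : y ∈ Metric.ball a L) :
    Real.exp (-(1 / 4 : ℝ)) / (4 * Real.pi * L ^ 2) ≤ gaussWin L a y := by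
  rw [gaussWin]
  have hL2 : 0 < 4 * Real.pi * L ^ 2 := by positivity
  refine div_le_div_of_nonneg_right (Real.exp_le_exp.2 ?_) hL2.le
  have hd : ‖y - a‖ < L := by rwa [Metric.mem_ball, dist_eq_norm] at hy
  have h1 : ‖y - a‖ ^ 2 ≤ L ^ 2 := by
    exact pow_le_pow_left₀ (norm_nonneg _) hd.le 2
  rw [neg_div, neg_le_neg_iff, div_le_div_iff₀ (by positivity) (by norm_num : (0 : ℝ) < 4)]
  nlinarith

/-- **Disc circulation law of the sign class.**  If `⟪curl V(x), e₃⟫ ≥ 0` everywhere and the windowed flux of width `L`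
centred at `a` through the plane `{x₂ = c}` is at most `Φ`, then the circulation of the disc `B_L(a)` in that plane is at
most `4π e^{1/4} L² Φ` (lower integral form; `1_{B_L(a)} ≤ 4π e^{1/4} L² g_{L,a}`). -/
theorem setLIntegral_ball_le_of_windowed {V : EuclideanSpace ℝ (Fin 3) → EuclideanSpace ℝ (Fin 3)}
    (hnn : ∀ x, 0 ≤ ⟪curl V x, e3⟫_ℝ) {L : ℝ} (hL : 0 < L) (c : ℝ) (a : EuclideanSpace ℝ (Fin 2)) {Φ : ℝ}
    (hwin : ∫⁻ y, ENNReal.ofReal (⟪curl V (planePt c y), e3⟫_ℝ * gaussWin L a y) ≤ ENNReal.ofReal Φ) :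
    ∫⁻ y in Metric.ball a L, ENNReal.ofReal ⟪curl V (planePt c y), e3⟫_ℝ ≤
      ENNReal.ofReal (4 * Real.pi * Real.exp (1 / 4 : ℝ) * L ^ 2 * Φ) := by
  set M : ℝ := 4 * Real.pi * Real.exp (1 / 4 : ℝ) * L ^ 2 with hM
  have hM0 : 0 ≤ M := by positivity
  -- pointwise on the disc: `ω₃ ≤ M · (ω₃ g)`
  have hpt : ∀ y ∈ Metric.ball a L, ENNReal.ofReal ⟪curl V (planePt c y), e3⟫_ℝ ≤
      ENNReal.ofReal M * ENNReal.ofReal (⟪curl V (planePt c y), e3⟫_ℝ * gaussWin L a y) := by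
    intro y hy
    rw [← ENNReal.ofReal_mul hM0]
    refine ENNReal.ofReal_le_ofReal ?_
    have hg := gaussWin_ge_on_ball hL hy
    have hω := hnn (planePt c y)
    have hMg : 1 ≤ M * gaussWin L a y := by
      have h1 : M * (Real.exp (-(1 / 4 : ℝ)) / (4 * Real.pi * L ^ 2)) = 1 := by
        rw [hM, Real.exp_neg]
        field_simp
      calc (1 : ℝ) = M * (Real.exp (-(1 / 4 : ℝ)) / (4 * Real.pi * L ^ 2)) := h1.symm
        _ ≤ M * gaussWin L a y := mul_le_mul_of_nonneg_left hg hM0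
    calc ⟪curl V (planePt c y), e3⟫_ℝ = ⟪curl V (planePt c y), e3⟫_ℝ * 1 := (mul_one _).symm
      _ ≤ ⟪curl V (planePt c y), e3⟫_ℝ * (M * gaussWin L a y) := mul_le_mul_of_nonneg_left hMg hω
      _ = M * (⟪curl V (planePt c y), e3⟫_ℝ * gaussWin L a y) := by ring
  calc ∫⁻ y in Metric.ball a L, ENNReal.ofReal ⟪curl V (planePt c y), e3⟫_ℝ
      ≤ ∫⁻ y in Metric.ball a L, ENNReal.ofReal M * ENNReal.ofReal (⟪curl V (planePt c y), e3⟫_ℝ * gaussWin L a y) :=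
        setLIntegral_mono' Metric.isOpen_ball.measurableSet hpt
    _ ≤ ∫⁻ y, ENNReal.ofReal M * ENNReal.ofReal (⟪curl V (planePt c y), e3⟫_ℝ * gaussWin L a y) :=
        setLIntegral_le_lintegral _ _
    _ = ENNReal.ofReal M * ∫⁻ y, ENNReal.ofReal (⟪curl V (planePt c y), e3⟫_ℝ * gaussWin L a y) := by
        rw [lintegral_const_mul' _ _ ENNReal.ofReal_ne_top]
    _ ≤ ENNReal.ofReal M * ENNReal.ofReal Φ := mul_le_mul_right hwin _
    _ = ENNReal.ofReal (M * Φ) := (ENNReal.ofReal_mul hM0).symm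

/-- **DISC CIRCULATIONS OF A CLOSED-HEMISPHERE TYPE-I PROFILE GROW AT MOST LINEARLY IN THE RADIUS.**  For a profile of the
route's Type-I class (rate `C`) with `⟪curl v(s), e₃⟫ ≥ 0`, on every horizontal plane `{x₂ = c}`, every disc `B_L(a)` and
every `s < 0`: `∫_{B_L(a)} ⟪curl v(s)(y₀,y₁,c), e₃⟫ dy ≤ 16π e^{1/4} C · L/√(−s)` (the windowed law `stub_windowedFluxDecay`,
`K = 4C`, against `1_{B_L(a)} ≤ 4π e^{1/4} L² g_{L,a}`).  Disc fluxes of size `L²/(−s)` (a vortex LAYER filling the disc at the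
Type-I vorticity scale) are thus excluded for `L ≫ √(−s)`; what the open stub must still kill is flux of size `L/√(−s)`. -/
theorem setLIntegral_ball_inner_curl_e3_le :
    ∀ (C : ℝ) (v : ℝ → EuclideanSpace ℝ (Fin 3) → EuclideanSpace ℝ (Fin 3)),
    Literature.Analysis.FluidPDE.HasTypeITimeDecay C v →
    ContinuousOn (Function.uncurry v) (Set.Iio (0 : ℝ) ×ˢ Set.univ) →
    (∀ s t : ℝ, s < t → t < 0 → ∀ x, v t x =
      Literature.Analysis.UnboundedOperators.heatExtension (v s) (t - s) x -
        Literature.Analysis.FluidPDE.oseenDuhamel 1 s v v t x) →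
    (∀ t < 0, Literature.Analysis.FluidPDE.VectorCalculus.IsDivFree (v t)) →
    (∀ s < 0, ∀ y, 0 ≤ ⟪Literature.Analysis.FluidPDE.curl (v s) y, e3⟫_ℝ) →
    ∀ s < 0, ∀ L : ℝ, 0 < L → ∀ (c : ℝ) (a : EuclideanSpace ℝ (Fin 2)),
      ∫⁻ y in Metric.ball a L, ENNReal.ofReal ⟪Literature.Analysis.FluidPDE.curl (v s) (planePt c y), e3⟫_ℝ ≤
        ENNReal.ofReal (16 * Real.pi * Real.exp (1 / 4 : ℝ) * C * L / Real.sqrt (-s)) := by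
  intro C v hrate hcont hmild hdiv hnn s hs L hL c a
  have hC0 : 0 ≤ C := by
    have h := hrate (-1) (by norm_num) 0
    rw [neg_neg, Real.sqrt_one, div_one] at h
    exact (norm_nonneg _).trans h
  -- the slice is smooth with bounded gradient; the windowed Kelvin–Stokes bound with `B = C/√(−s)`
  have hA : AnalyticOnNhd ℝ (v s) univ := analyticOnNhd_slice hcont (bdd_of_hasTypeITimeDecay hrate) hmild hs
  have hVd : Differentiable ℝ (v s) := fun x => (hA x (mem_univ x)).differentiableAt
  have hVc : Continuous (fderiv ℝ (v s)) := continuousOn_univ.1 hA.fderiv.continuousOn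
  obtain ⟨K₁, -, hK₁⟩ := exists_fderiv_rate_of_class' hrate hcont hmild
  obtain ⟨hint, hle⟩ := windowedCirculation_le hVd hVc (fun x => hrate s hs x) (hK₁ s hs) hL c a
  have hsq : 0 < Real.sqrt (-s) := Real.sqrt_pos.2 (neg_pos.2 hs)
  have hnn' : 0 ≤ᵐ[volume] fun y => ⟪curl (v s) (planePt c y), e3⟫_ℝ * gaussWin L a y :=
    ae_of_all _ fun y => mul_nonneg (hnn s hs _) (gaussWin_pos hL a y).le
  have hwin : ∫⁻ y, ENNReal.ofReal (⟪curl (v s) (planePt c y), e3⟫_ℝ * gaussWin L a y) ≤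
      ENNReal.ofReal (4 * (C / Real.sqrt (-s)) / L) := by
    rw [← ofReal_integral_eq_lintegral_ofReal hint hnn']
    exact ENNReal.ofReal_le_ofReal ((le_abs_self _).trans hle)
  have h := setLIntegral_ball_le_of_windowed (hnn s hs) hL c a hwin
  refine h.trans (le_of_eq ?_)
  congr 1
  field_simp
  ring

end Summit.NavierStokesRegularity.NavierStokesRegularity.Theorems.HalfSpaceWindowDoorCirculationCarryingRigidityReduction

end
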